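import Summits.HubbardSuperconductivity.HubbardSuperconductivity.Theorems.AnisotropyChordTransferFibre3FinXDCheck

/-!
# Route `AnisotropyChord` / H0 rotor rung: FIN per-`L` row-D (KT-2a″) SUB-CELL facts, `L = 9` (60–65)

Row-D facts `xdCellAny0 9 (49/50) la lb aD = true` on quarter sub-cells of the combined cells whose side condition needs `aD ≈ .04` (mechhunt STATUS p3 g7 REPORT 3).
Prover seat `hubbard-h0-rotor-p3` g7; helper for piece A = stmt-HubbardSuperconductivity-23918 of rung 19089 (`--supports`, helper class).
WHAT THIS IS NOT: nothing here proves superconductivity in the Hubbard model (rotor TARGET as worded stays FALSE, g15 verdict); kernel facts /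
assembly for ONE conditional reduction at one `L`.  No sorry.
-/

set_option linter.dupNamespace false
set_option autoImplicit false

namespace Summit.HubbardSuperconductivity.HubbardSuperconductivity.Theorems.AnisotropyChord.Transfer.Fibre3

namespace FinXD

/-- row-D sub-cell `[15577660808624431, 15675021188678334]` of `L = 9`. [folklore] -/
theorem xd9s_126_0 : xdCellAny0 9 (49/50 : ℚ) 15577660808624431 15675021188678334 (1/25 : ℚ) = true := by decide +kernel

/-- row-D sub-cell `[15675021188678334, 15772381568732237]` of `L = 9`. [folklore] -/
theorem xd9s_126_1 : xdCellAny0 9 (49/50 : ℚ) 15675021188678334 15772381568732237 (1/25 : ℚ) = true := by decide +kernel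

/-- row-D sub-cell `[15772381568732237, 15869741948786140]` of `L = 9`. [folklore] -/
theorem xd9s_126_2 : xdCellAny0 9 (49/50 : ℚ) 15772381568732237 15869741948786140 (1/25 : ℚ) = true := by decide +kernel

/-- row-D sub-cell `[15869741948786140, 15967102328840043]` of `L = 9`. [folklore] -/
theorem xd9s_126_3 : xdCellAny0 9 (49/50 : ℚ) 15869741948786140 15967102328840043 (1/25 : ℚ) = true := by decide +kernel

/-- row-D sub-cell `[15967102328840043, 16066896718395293]` of `L = 9`. [folklore] -/
theorem xd9s_127_0 : xdCellAny0 9 (49/50 : ℚ) 15967102328840043 16066896718395293 (1/25 : ℚ) = true := by decide +kernel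

/-- row-D sub-cell `[16066896718395293, 16166691107950544]` of `L = 9`. [folklore] -/
theorem xd9s_127_1 : xdCellAny0 9 (49/50 : ℚ) 16066896718395293 16166691107950544 (1/25 : ℚ) = true := by decide +kernel

end FinXD

end Summit.HubbardSuperconductivity.HubbardSuperconductivity.Theorems.AnisotropyChord.Transfer.Fibre3
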